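import Literature.Analysis.FluidPDE.LocalLerayPairingContinuity
import Literature.Analysis.FluidPDE.WeakSolutionWeakContinuity
import Literature.Analysis.FunctionSpaces.TestFunctionDensity
import Mathlib.Analysis.Normed.Lp.SmoothApprox
import HarnessLib

/-!
# Local Leray solutions have weak traces in `L²_loc` at every positive time

Analysis/FluidPDE proof file (no new definitions, no new named facts). It proves the content of the
named fact `leray_solution_weak_trace` (`NSLerayHopfSereginWeakTrace.lean`; Kang–Miura–Tsai 2021,
Def. 3.1 (6) with the remark after it and Lemma 3.4; Lemarié-Rieusset 2016, p. 568: local Leray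
solutions are weakly continuous in time after redefinition on a null set of times) in the
a.e.-robust form used by the tree: for a local Leray solution `(v, p)`
(`IsLocalLeraySolution ν v₀ v p`, Kang–Miura–Tsai Def. 3.2) and `T > 0` there is a measurable field
`v_T` with `|v_T|² ∈ L¹_loc` such that `∫ ⟪v(t), φ⟫ → ∫ ⟪v_T, φ⟫` along a.e. `t → T` (filter
`𝓝 T ⊓ ae volume`) for every test field `φ` (`IsLocalLeraySolution.exists_weak_trace`).

## The proof

1. *Essential limits of the pairings* exist for every test field (the previous layer,
   `IsDistributionalNSSolutionOn.exists_tendsto_pairing_nhds_inf_ae`,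
   `LocalLerayPairingContinuity.lean`: the momentum equation tested with `χ(t) η(x)` and the
   du Bois-Reymond lemma).
2. *A representing field on each ball.* Fix `k ∈ ℕ` and a smooth cut-off `χ_k`, `0 ≤ χ_k ≤ 1`,
   `χ_k = 1` on `B̄(0, k)`, supported in `B(0, k+1)`. Along the good times `t` near `T` (a.e.
   slice measurable, `∫_{B(0, R)} |v(t)|² ≤ C` by the uniformly local energy bound with
   `R = k + T + 1`, `T < R²`) the classes `[χ_k v(t)] ∈ L²(ℝ³; ℝ³)` are bounded, and their
   pairings with the class of any test field `φ` are the pairings `∫ ⟪v(t), χ_k φ⟫` of step 1,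
   hence convergent; the classes of test fields being dense in `L²` (Mathlib's
   `Lp.dense_hasCompactSupport_contDiff`), the abstract weak-limit lemma
   `exists_forall_tendsto_inner_of_dense_span` (`WeakSolutionWeakContinuity.lean`: `ε/3` and the
   Riesz representation in the Hilbert space `L²`) yields `Y_k ∈ L²` with `[χ_k v(t)] ⇀ Y_k`; in
   particular `∫ ⟪v(t), φ⟫ → ∫ ⟪Y_k, φ⟫` for test fields supported in `B̄(0, k)`.
3. *Consistency and patching.* For `j ≤ k`, `Y_j = Y_k` a.e. on `B(0, j)` (both represent the same
   limits against the fields `g(x) c`, `g ∈ C_c^∞(B(0, j))`, `c ∈ ℝ³`; fundamental lemma of the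
   calculus of variations, Mathlib's `IsOpen.ae_eq_zero_of_integral_contDiff_smul_eq_zero`), so
   `v_T(x) = Y_{⌊|x|⌋+1}(x)` is measurable, equals `Y_k` a.e. on `B(0, k)`, lies in `L²_loc`, and
   represents the limits against every test field.

This is the standard construction of the weakly continuous representative (Temam 1977, Ch. III,
Lemma 1.4; Galdi 2000, Lemma 2.2; Sohr 2001, Thm. V.1.3.1), localised to `L²_loc` because local
Leray solutions have only uniformly local energy.

## References

* K. Kang, H. Miura, T.-P. Tsai, IMRN 2021 = arXiv:1812.10509, §3: Def. 3.1 (6), the remark after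
  Def. 3.1, Def. 3.2, Lemma 3.4.
* P. G. Lemarié-Rieusset, *The Navier–Stokes Problem in the 21st Century* (2016), p. 568,
  Def. 14.1.
* R. Temam, *Navier–Stokes Equations* (1977), Ch. III, §1, Lemmas 1.1, 1.4.
-/

noncomputable section

open MeasureTheory Set Function Filter Topology TopologicalSpace Metric
open scoped NNReal ENNReal RealInnerProductSpace

namespace Literature.Analysis.FluidPDE

/-! ### General tools -/

section General

variable {E : Type*} [NormedAddCommGroup E] [InnerProductSpace ℝ E] [FiniteDimensional ℝ E]
  [MeasurableSpace E] [BorelSpace E]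

/-- The filter of "almost every `t` near `T`", `𝓝 T ⊓ ae volume`, is non-trivial on `ℝ`.
[folklore] -/
theorem nhds_inf_ae_neBot (T : ℝ) : (𝓝 T ⊓ ae (volume : Measure ℝ)).NeBot :=
  (nhdsLT_inf_ae_neBot T).mono (inf_le_inf_right _ nhdsWithin_le_nhds)

/-- **The classes of test fields span a dense subspace of `L²(E; E)`** (they are even dense:
Mathlib's `Lp.dense_hasCompactSupport_contDiff`). [folklore] -/
theorem dense_span_testField_classes :
    Dense ((Submodule.span ℝ {d : Lp E 2 (volume : Measure E) | ∃ φ : E → E,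
      FunctionSpaces.IsTestFunctionOn (⊤ : Opens E) φ ∧ (d : E → E) =ᵐ[volume] φ} :
        Submodule ℝ (Lp E 2 (volume : Measure E))) : Set (Lp E 2 (volume : Measure E))) := by
  have h := MeasureTheory.Lp.dense_hasCompactSupport_contDiff (F := E) (μ := (volume : Measure E))
    (p := 2) ENNReal.ofNat_ne_top
  refine (h.mono ?_).mono Submodule.subset_span
  rintro d ⟨g, hdg, hgc, hgs⟩
  exact ⟨g, ⟨hgs, hgc, by simp⟩, hdg⟩

omit [FiniteDimensional ℝ E] [MeasurableSpace E] [BorelSpace E] in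
/-- A smooth scalar function times a test field is a test field. [folklore] -/
theorem isTestFunctionOn_smul_top {χ : E → ℝ} (hχ : ContDiff ℝ (⊤ : ℕ∞) χ) {φ : E → E}
    (hφ : FunctionSpaces.IsTestFunctionOn (⊤ : Opens E) φ) :
    FunctionSpaces.IsTestFunctionOn (⊤ : Opens E) (fun x => χ x • φ x) :=
  ⟨hχ.smul hφ.contDiff, hφ.hasCompactSupport.smul_left, by simp⟩

omit [FiniteDimensional ℝ E] [MeasurableSpace E] [BorelSpace E] in
/-- A smooth compactly supported scalar function times a constant vector is a test field, with the
same support control. [folklore] -/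
theorem isTestFunctionOn_smul_const_top {g : E → ℝ} (hg : ContDiff ℝ (⊤ : ℕ∞) g)
    (hgc : HasCompactSupport g) (c : E) :
    FunctionSpaces.IsTestFunctionOn (⊤ : Opens E) (fun x => g x • c) :=
  ⟨hg.smul contDiff_const, hgc.smul_right, by simp⟩

omit [FiniteDimensional ℝ E] [MeasurableSpace E] [BorelSpace E] in
/-- The support of `x ↦ g(x) c` lies in that of `g`. [folklore] -/
theorem tsupport_smul_const_subset (g : E → ℝ) (c : E) :
    tsupport (fun x => g x • c) ⊆ tsupport g :=
  closure_mono fun x hx => by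
    rw [mem_support] at hx ⊢
    exact fun h => hx (by rw [h, zero_smul])

/-- **Pairings of `L²` classes with classes of test fields are integrals.** If `d = φ` a.e. then
`⟪X, d⟫ = ∫ ⟪X, φ⟫`. [folklore] -/
theorem inner_eq_integral_of_ae_eq (X d : Lp E 2 (volume : Measure E)) {φ : E → E}
    (hd : (d : E → E) =ᵐ[volume] φ) : ⟪X, d⟫ = ∫ x, ⟪(X : E → E) x, φ x⟫ := by
  rw [MeasureTheory.L2.inner_def]
  exact integral_congr_ae (hd.mono fun x hx => by simp only [hx])

end General

/-! ### The construction -/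

section Trace

variable {ν : ℝ} {v₀ : EuclideanSpace ℝ (Fin 3) → EuclideanSpace ℝ (Fin 3)}
  {v : ℝ → EuclideanSpace ℝ (Fin 3) → EuclideanSpace ℝ (Fin 3)}
  {p : ℝ → EuclideanSpace ℝ (Fin 3) → ℝ}

/-- **Good times near `T`**: along a.e. `t` near `T > 0`, the slice `v(t)` of a local Leray
solution is measurable and `∫_{B(0, k+1)} |v(t)|² ≤ C_k` (uniformly local energy at radius
`R = k + T + 1`, window `(0, R²) ∋ T`; Tonelli for the measurability of a.e. slice). [folklore] -/
theorem IsLocalLeraySolution.eventually_good_slice (hv : IsLocalLeraySolution ν v₀ v p) {T : ℝ}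
    (hT : 0 < T) (k : ℕ) :
    ∃ C : ℝ≥0, ∀ᶠ t in 𝓝 T ⊓ ae (volume : Measure ℝ),
      AEStronglyMeasurable (v t) volume ∧
        ∫⁻ x in ball (0 : EuclideanSpace ℝ (Fin 3)) (k + 1), ‖v t x‖ₑ ^ 2 ≤ C := by
  set R : ℝ := k + T + 1 with hR_def
  have hR : 0 < R := by rw [hR_def]; positivity
  have hR1 : (k : ℝ) + 1 ≤ R := by rw [hR_def]; linarith
  have hTR : T < R ^ 2 := by
    have h1 : 1 ≤ R := by rw [hR_def]; linarith [k.cast_nonneg (α := ℝ)]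
    nlinarith
  obtain ⟨C, hC⟩ := hv.uniformLocalEnergy R hR
  refine ⟨C, ?_⟩
  -- slices: measurable for a.e. `t ∈ (0, R²)`
  have hmeas : AEStronglyMeasurable (uncurry v)
      ((volume : Measure (ℝ × EuclideanSpace ℝ (Fin 3))).restrict (Ioo 0 (R ^ 2) ×ˢ univ)) :=
    hv.aestronglyMeasurable.mono_measure
      (Measure.restrict_mono (prod_mono Ioo_subset_Ioi_self subset_rfl) le_rfl)
  have hslice := ae_slice_aestronglyMeasurable_and_lintegral_ball_lt_top hmeas
    (fun K hK => hv.sqIntegrable (R ^ 2) (by positivity) K hK)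
  have h1 := (ae_restrict_iff' (measurableSet_Ioo (a := (0 : ℝ)) (b := R ^ 2))).1 hslice
  have h2 := (ae_restrict_iff' (measurableSet_Ioo (a := (0 : ℝ)) (b := R ^ 2))).1 hC
  have hI : ∀ᶠ t in 𝓝 T ⊓ ae (volume : Measure ℝ), t ∈ Ioo 0 (R ^ 2) :=
    mem_inf_of_left (Ioo_mem_nhds hT hTR)
  filter_upwards [hI, mem_inf_of_right (f := 𝓝 T) h1, mem_inf_of_right (f := 𝓝 T) h2]
    with t htI hm hb
  refine ⟨(hm htI).1, ?_⟩
  calc ∫⁻ x in ball (0 : EuclideanSpace ℝ (Fin 3)) (k + 1), ‖v t x‖ₑ ^ 2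
      ≤ ∫⁻ x in ball (0 : EuclideanSpace ℝ (Fin 3)) R, ‖v t x‖ₑ ^ 2 :=
        lintegral_mono_set (ball_subset_ball hR1)
    _ ≤ C := hb htI 0

/-- **The representing field on a ball.** For a local Leray solution, `T > 0` and `k ∈ ℕ` there is
`Y ∈ L²(ℝ³; ℝ³)` (a strongly measurable representative) such that
`∫ ⟪v(t), φ⟫ → ∫ ⟪Y, φ⟫` along a.e. `t → T` for every test field `φ` supported in `B̄(0, k)`:
weak limit of the bounded classes `[χ_k v(t)]` obtained from the convergence of their pairings with
the dense set of classes of test fields (`exists_forall_tendsto_inner_of_dense_span`).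
[folklore] -/
theorem IsLocalLeraySolution.exists_weak_trace_ball (hv : IsLocalLeraySolution ν v₀ v p) {T : ℝ}
    (hT : 0 < T) (k : ℕ) :
    ∃ Y : EuclideanSpace ℝ (Fin 3) → EuclideanSpace ℝ (Fin 3),
      StronglyMeasurable Y ∧ MemLp Y 2 volume ∧
      ∀ φ : EuclideanSpace ℝ (Fin 3) → EuclideanSpace ℝ (Fin 3),
        FunctionSpaces.IsTestFunctionOn (⊤ : Opens (EuclideanSpace ℝ (Fin 3))) φ →
        tsupport φ ⊆ closedBall (0 : EuclideanSpace ℝ (Fin 3)) k →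
        Tendsto (fun t => ∫ x, ⟪v t x, φ x⟫) (𝓝 T ⊓ ae (volume : Measure ℝ))
          (𝓝 (∫ x, ⟪Y x, φ x⟫)) := by
  haveI : (𝓝 T ⊓ ae (volume : Measure ℝ)).NeBot := nhds_inf_ae_neBot T
  -- the cut-off `χ`: `1` on `B̄(0,k)`, supported in `B(0, k+1)`, values in `[0,1]`
  obtain ⟨χ, hχ, hχc, hχsupp, hχ1, hχ01⟩ := FunctionSpaces.exists_smooth_cutoff_mem_Icc
    (isCompact_closedBall (0 : EuclideanSpace ℝ (Fin 3)) k) isOpen_ball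
    (closedBall_subset_ball (lt_add_one (k : ℝ)))
  have hχcont : Continuous χ := hχ.continuous
  -- good times
  obtain ⟨C, hgood⟩ := hv.eventually_good_slice hT k
  -- the truncated slices are in `L²` with norm ≤ `M` at good times
  set M : ℝ := ((C : ℝ≥0∞) ^ (1 / 2 : ℝ)).toReal with hM_def
  have hmem : ∀ t, AEStronglyMeasurable (v t) volume →
      ∫⁻ x in ball (0 : EuclideanSpace ℝ (Fin 3)) (k + 1), ‖v t x‖ₑ ^ 2 ≤ C →
      MemLp (fun x => χ x • v t x) 2 volume ∧
        eLpNorm (fun x => χ x • v t x) 2 volume ≤ (C : ℝ≥0∞) ^ (1 / 2 : ℝ) := by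
    intro t hm hb
    have hmeas : AEStronglyMeasurable (fun x => χ x • v t x) volume :=
      hχcont.aestronglyMeasurable.smul hm
    have hpt : ∀ x, ‖χ x • v t x‖ₑ ^ 2 ≤
        (ball (0 : EuclideanSpace ℝ (Fin 3)) (k + 1)).indicator (fun x => ‖v t x‖ₑ ^ 2) x := by
      intro x
      by_cases hx : x ∈ ball (0 : EuclideanSpace ℝ (Fin 3)) (k + 1)
      · rw [indicator_of_mem hx, enorm_smul]
        have h1 : ‖χ x‖ₑ ≤ 1 := by
          rw [Real.enorm_eq_ofReal (hχ01 x).1]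
          exact ENNReal.ofReal_le_one.2 (hχ01 x).2
        calc (‖χ x‖ₑ * ‖v t x‖ₑ) ^ 2 ≤ (1 * ‖v t x‖ₑ) ^ 2 := by gcongr
          _ = ‖v t x‖ₑ ^ 2 := by rw [one_mul]
      · have h0 : χ x = 0 := image_eq_zero_of_notMem_tsupport fun h => hx (hχsupp h)
        rw [indicator_of_notMem hx, h0, zero_smul, enorm_zero, zero_pow two_ne_zero]
    have hlin : ∫⁻ x, ‖χ x • v t x‖ₑ ^ 2 ≤ C :=
      calc ∫⁻ x, ‖χ x • v t x‖ₑ ^ 2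
          ≤ ∫⁻ x, (ball (0 : EuclideanSpace ℝ (Fin 3)) (k + 1)).indicator
              (fun x => ‖v t x‖ₑ ^ 2) x := lintegral_mono hpt
        _ = ∫⁻ x in ball (0 : EuclideanSpace ℝ (Fin 3)) (k + 1), ‖v t x‖ₑ ^ 2 :=
            lintegral_indicator measurableSet_ball _
        _ ≤ C := hb
    have hnorm : eLpNorm (fun x => χ x • v t x) 2 volume ≤ (C : ℝ≥0∞) ^ (1 / 2 : ℝ) := by
      rw [eLpNorm_eq_lintegral_rpow_enorm_toReal two_ne_zero ENNReal.ofNat_ne_top,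
        ENNReal.toReal_ofNat, one_div]
      have e : ∫⁻ x, ‖χ x • v t x‖ₑ ^ (2 : ℝ) = ∫⁻ x, ‖χ x • v t x‖ₑ ^ 2 :=
        lintegral_congr fun x => by rw [← ENNReal.rpow_natCast]; norm_num
      rw [e]
      exact ENNReal.rpow_le_rpow hlin (by norm_num)
    exact ⟨⟨hmeas, lt_of_le_of_lt hnorm (ENNReal.rpow_lt_top_of_nonneg (by norm_num)
      ENNReal.coe_ne_top)⟩, hnorm⟩
  -- the classes
  classical
  set X : ℝ → Lp (EuclideanSpace ℝ (Fin 3)) 2 (volume : Measure (EuclideanSpace ℝ (Fin 3))) :=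
    fun t => if h : MemLp (fun x => χ x • v t x) 2 volume then h.toLp _ else 0 with hX_def
  have hXgood : ∀ t, AEStronglyMeasurable (v t) volume →
      ∫⁻ x in ball (0 : EuclideanSpace ℝ (Fin 3)) (k + 1), ‖v t x‖ₑ ^ 2 ≤ C →
      ∃ h : MemLp (fun x => χ x • v t x) 2 volume, X t = h.toLp _ ∧ ‖X t‖ ≤ M := by
    intro t hm hb
    obtain ⟨h, hnorm⟩ := hmem t hm hb
    refine ⟨h, by rw [hX_def]; exact dif_pos h, ?_⟩
    rw [hX_def]
    simp only [dif_pos h, Lp.norm_toLp, hM_def]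
    exact ENNReal.toReal_mono (ENNReal.rpow_ne_top_of_nonneg (by norm_num) ENNReal.coe_ne_top) hnorm
  have hbound : ∀ᶠ t in 𝓝 T ⊓ ae (volume : Measure ℝ), ‖X t‖ ≤ M := by
    filter_upwards [hgood] with t ht
    exact (hXgood t ht.1 ht.2).choose_spec.2
  -- pairings of the classes with classes of test fields are pairings of `v t` with `χ φ`
  have hpair : ∀ t, AEStronglyMeasurable (v t) volume →
      ∫⁻ x in ball (0 : EuclideanSpace ℝ (Fin 3)) (k + 1), ‖v t x‖ₑ ^ 2 ≤ C →
      ∀ (d : Lp (EuclideanSpace ℝ (Fin 3)) 2 (volume : Measure (EuclideanSpace ℝ (Fin 3))))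
        (φ : EuclideanSpace ℝ (Fin 3) → EuclideanSpace ℝ (Fin 3)),
        (d : EuclideanSpace ℝ (Fin 3) → EuclideanSpace ℝ (Fin 3)) =ᵐ[volume] φ →
        ⟪X t, d⟫ = ∫ x, ⟪v t x, χ x • φ x⟫ := by
    intro t hm hb d φ hd
    obtain ⟨h, hX, -⟩ := hXgood t hm hb
    rw [hX, MeasureTheory.L2.inner_def]
    refine integral_congr_ae ?_
    filter_upwards [h.coeFn_toLp, hd] with x hx hdx
    rw [hx, hdx, real_inner_smul_left, real_inner_smul_right]
  -- convergence of the pairings against the dense set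
  set D : Set (Lp (EuclideanSpace ℝ (Fin 3)) 2 (volume : Measure (EuclideanSpace ℝ (Fin 3)))) :=
    {d | ∃ φ : EuclideanSpace ℝ (Fin 3) → EuclideanSpace ℝ (Fin 3),
      FunctionSpaces.IsTestFunctionOn (⊤ : Opens (EuclideanSpace ℝ (Fin 3))) φ ∧
        (d : EuclideanSpace ℝ (Fin 3) → EuclideanSpace ℝ (Fin 3)) =ᵐ[volume] φ} with hD_def
  have hconv : ∀ d ∈ D, ∃ L : ℝ, Tendsto (fun t => ⟪X t, d⟫) (𝓝 T ⊓ ae (volume : Measure ℝ))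
      (𝓝 L) := by
    rintro d ⟨φ, hφ, hdφ⟩
    obtain ⟨L, hL⟩ := hv.distributional.exists_tendsto_pairing_nhds_inf_ae hT
      (isTestFunctionOn_smul_top hχ hφ)
    refine ⟨L, hL.congr' ?_⟩
    filter_upwards [hgood] with t ht
    exact (hpair t ht.1 ht.2 d φ hdφ).symm
  obtain ⟨Y, -, hY⟩ := exists_forall_tendsto_inner_of_dense_span hbound dense_span_testField_classes
    hconv
  -- a strongly measurable representative
  refine ⟨(Lp.memLp Y).aestronglyMeasurable.mk _, (Lp.memLp Y).aestronglyMeasurable.stronglyMeasurable_mk,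
    (Lp.memLp Y).ae_eq (Lp.memLp Y).aestronglyMeasurable.ae_eq_mk, fun φ hφ hφk => ?_⟩
  have hφ2 : MemLp φ 2 (volume : Measure (EuclideanSpace ℝ (Fin 3))) :=
    hφ.contDiff.continuous.memLp_of_hasCompactSupport hφ.hasCompactSupport
  have hd : ((hφ2.toLp φ : Lp (EuclideanSpace ℝ (Fin 3)) 2 volume) :
      EuclideanSpace ℝ (Fin 3) → EuclideanSpace ℝ (Fin 3)) =ᵐ[volume] φ := hφ2.coeFn_toLp
  have h1 := hY (hφ2.toLp φ)
  -- `χ φ = φ`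
  have hχφ : ∀ x, χ x • φ x = φ x := by
    intro x
    by_cases hx : x ∈ tsupport φ
    · rw [hχ1 x (hφk hx), one_smul]
    · rw [image_eq_zero_of_notMem_tsupport hx, smul_zero]
  have hlim : ⟪Y, hφ2.toLp φ⟫ = ∫ x, ⟪(Lp.memLp Y).aestronglyMeasurable.mk _ x, φ x⟫ := by
    rw [inner_eq_integral_of_ae_eq Y _ hd]
    exact integral_congr_ae (((Lp.memLp Y).aestronglyMeasurable.ae_eq_mk).mono
      fun x hx => by simp only [hx])
  rw [← hlim]
  refine h1.congr' ?_
  filter_upwards [hgood] with t ht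
  rw [hpair t ht.1 ht.2 _ φ hd]
  exact integral_congr_ae (Eventually.of_forall fun x => by simp only [hχφ x])

/-- **Consistency of representing fields.** Two `L²` fields whose pairings with every test field
supported in the ball `B(0, r)` agree are a.e. equal on `B(0, r)` (fundamental lemma of the
calculus of variations, tested with `g(x) c`, `g ∈ C_c^∞(B(0, r))`, `c ∈ ℝ³`). [folklore] -/
theorem ae_eq_on_ball_of_forall_test_pairing_eq
    {Y Y' : EuclideanSpace ℝ (Fin 3) → EuclideanSpace ℝ (Fin 3)} (hY : MemLp Y 2 volume)
    (hY' : MemLp Y' 2 volume) {r : ℝ}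
    (h : ∀ φ : EuclideanSpace ℝ (Fin 3) → EuclideanSpace ℝ (Fin 3),
      FunctionSpaces.IsTestFunctionOn (⊤ : Opens (EuclideanSpace ℝ (Fin 3))) φ →
      tsupport φ ⊆ ball (0 : EuclideanSpace ℝ (Fin 3)) r →
      ∫ x, ⟪Y x, φ x⟫ = ∫ x, ⟪Y' x, φ x⟫) :
    ∀ᵐ x ∂(volume : Measure (EuclideanSpace ℝ (Fin 3))),
      x ∈ ball (0 : EuclideanSpace ℝ (Fin 3)) r → Y x = Y' x := by
  set f : EuclideanSpace ℝ (Fin 3) → EuclideanSpace ℝ (Fin 3) := fun x => Y x - Y' x with hf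
  have hfloc : LocallyIntegrable f volume := (hY.sub hY').locallyIntegrable one_le_two
  have key := IsOpen.ae_eq_zero_of_integral_contDiff_smul_eq_zero (isOpen_ball (x := (0 :
      EuclideanSpace ℝ (Fin 3))) (ε := r)) (hfloc.locallyIntegrableOn _) ?_
  · filter_upwards [key] with x hx hxr
    exact sub_eq_zero.1 (hx hxr)
  intro g hg hgc hgr
  have hint : Integrable (fun x => g x • f x) volume :=
    hfloc.integrable_smul_left_of_hasCompactSupport hg.continuous hgc
  refine integral_eq_zero_of_forall_integral_inner_eq_zero ℝ _ hint fun c => ?_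
  -- `∫ ⟪c, g f⟫ = ∫ ⟪Y, g c⟫ - ∫ ⟪Y', g c⟫ = 0`
  have hψ : FunctionSpaces.IsTestFunctionOn (⊤ : Opens (EuclideanSpace ℝ (Fin 3)))
      (fun x => g x • c) := isTestFunctionOn_smul_const_top (by exact_mod_cast hg) hgc c
  have hψr : tsupport (fun x => g x • c) ⊆ ball (0 : EuclideanSpace ℝ (Fin 3)) r :=
    (tsupport_smul_const_subset g c).trans hgr
  have hψ2 : MemLp (fun x => g x • c) 2 (volume : Measure (EuclideanSpace ℝ (Fin 3))) :=
    hψ.contDiff.continuous.memLp_of_hasCompactSupport hψ.hasCompactSupport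
  have hi : ∀ {Z : EuclideanSpace ℝ (Fin 3) → EuclideanSpace ℝ (Fin 3)}, MemLp Z 2 volume →
      Integrable (fun x => ⟪Z x, g x • c⟫) volume := by
    intro Z hZ
    have h1 := L2.integrable_inner (𝕜 := ℝ) (hZ.toLp Z) (hψ2.toLp _)
    refine h1.congr ?_
    filter_upwards [hZ.coeFn_toLp, hψ2.coeFn_toLp] with x hx hy
    rw [hx, hy]
  have e : (fun x => ⟪c, g x • f x⟫) = fun x => ⟪Y x, g x • c⟫ - ⟪Y' x, g x • c⟫ := by
    funext x
    rw [hf, ← inner_sub_left, real_inner_smul_right, real_inner_smul_right, real_inner_comm]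
  rw [e, integral_sub (hi hY) (hi hY'), h _ hψ hψr, sub_self]

/-- **Local Leray solutions have weak traces in `L²_loc` at every positive time** (the content of
`leray_solution_weak_trace`, `NSLerayHopfSereginWeakTrace.lean`; Kang–Miura–Tsai 2021, Def. 3.1 (6)
with the remark after it and Lemma 3.4; Lemarié-Rieusset 2016, p. 568). For a local Leray solution
`(v, p)` and `T > 0` there is a measurable `v_T` with `|v_T|² ∈ L¹_loc` such that
`∫ ⟪v(t), φ⟫ → ∫ ⟪v_T, φ⟫` along a.e. `t → T` for every test field `φ`: patch the representing
fields `Y_k` of the balls `B̄(0, k)` (`exists_weak_trace_ball`), which agree a.e. on the smaller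
balls (`ae_eq_on_ball_of_forall_test_pairing_eq`), along `k = ⌊|x|⌋ + 1`.
[cite: KangMiuraTsai2020, Def. 3.1 (6) with the remark after Def. 3.1, and Lemma 3.4] -/
theorem IsLocalLeraySolution.exists_weak_trace (hv : IsLocalLeraySolution ν v₀ v p) {T : ℝ}
    (hT : 0 < T) :
    ∃ vT : EuclideanSpace ℝ (Fin 3) → EuclideanSpace ℝ (Fin 3),
      AEStronglyMeasurable vT volume ∧ LocallyIntegrable (fun x => ‖vT x‖ ^ 2) volume ∧
      ∀ φ : EuclideanSpace ℝ (Fin 3) → EuclideanSpace ℝ (Fin 3),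
        FunctionSpaces.IsTestFunctionOn (⊤ : Opens (EuclideanSpace ℝ (Fin 3))) φ →
        Tendsto (fun t => ∫ x, ⟪v t x, φ x⟫) (𝓝 T ⊓ ae (volume : Measure ℝ))
          (𝓝 (∫ x, ⟪vT x, φ x⟫)) := by
  haveI : (𝓝 T ⊓ ae (volume : Measure ℝ)).NeBot := nhds_inf_ae_neBot T
  choose Y hYm hY2 hYlim using fun k : ℕ => hv.exists_weak_trace_ball hT k
  -- consistency on the smaller ball
  have hcons : ∀ j k : ℕ, j ≤ k → ∀ᵐ x ∂(volume : Measure (EuclideanSpace ℝ (Fin 3))),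
      x ∈ ball (0 : EuclideanSpace ℝ (Fin 3)) j → Y j x = Y k x := by
    intro j k hjk
    refine ae_eq_on_ball_of_forall_test_pairing_eq (hY2 j) (hY2 k) fun φ hφ hφj => ?_
    have hj : tsupport φ ⊆ closedBall (0 : EuclideanSpace ℝ (Fin 3)) j :=
      hφj.trans ball_subset_closedBall
    have hk : tsupport φ ⊆ closedBall (0 : EuclideanSpace ℝ (Fin 3)) k :=
      hj.trans (closedBall_subset_closedBall (by exact_mod_cast hjk))
    exact tendsto_nhds_unique (hYlim j φ hφ hj) (hYlim k φ hφ hk)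
  have hall : ∀ᵐ x ∂(volume : Measure (EuclideanSpace ℝ (Fin 3))), ∀ j k : ℕ, j ≤ k →
      x ∈ ball (0 : EuclideanSpace ℝ (Fin 3)) j → Y j x = Y k x := by
    refine ae_all_iff.2 fun j => ae_all_iff.2 fun k => ?_
    by_cases hjk : j ≤ k
    · filter_upwards [hcons j k hjk] with x hx using fun _ => hx
    · exact Eventually.of_forall fun x h => absurd h hjk
  -- the patched field
  set n : EuclideanSpace ℝ (Fin 3) → ℕ := fun x => ⌊‖x‖⌋₊ + 1 with hn
  have hn_meas : Measurable n := (Nat.measurable_floor.comp measurable_norm).add_const 1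
  have hxn : ∀ x : EuclideanSpace ℝ (Fin 3), x ∈ ball (0 : EuclideanSpace ℝ (Fin 3)) (n x) := by
    intro x
    rw [mem_ball_zero_iff, hn]
    push_cast
    exact Nat.lt_floor_add_one ‖x‖
  have hnle : ∀ (k : ℕ) (x : EuclideanSpace ℝ (Fin 3)), x ∈ ball (0 : EuclideanSpace ℝ (Fin 3)) k →
      n x ≤ k := by
    intro k x hx
    rw [mem_ball_zero_iff] at hx
    have : ⌊‖x‖⌋₊ < k := (Nat.floor_lt (norm_nonneg _)).2 hx
    show ⌊‖x‖⌋₊ + 1 ≤ k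
    omega
  set vT : EuclideanSpace ℝ (Fin 3) → EuclideanSpace ℝ (Fin 3) := fun x => Y (n x) x with hvT
  have hvT_meas : Measurable vT := by
    have hF : Measurable (fun q : EuclideanSpace ℝ (Fin 3) × ℕ => Y q.2 q.1) :=
      measurable_from_prod_countable_left fun k => (hYm k).measurable
    exact hF.comp (measurable_id.prodMk hn_meas)
  -- `vT = Y k` a.e. on `B(0, k)`
  have hvT_ball : ∀ k : ℕ, ∀ᵐ x ∂(volume : Measure (EuclideanSpace ℝ (Fin 3))),
      x ∈ ball (0 : EuclideanSpace ℝ (Fin 3)) k → vT x = Y k x := by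
    intro k
    filter_upwards [hall] with x hx hxk
    exact hx (n x) k (hnle k x hxk) (hxn x)
  refine ⟨vT, hvT_meas.aestronglyMeasurable, ?_, ?_⟩
  · -- `|vT|² ∈ L¹_loc`
    intro x₀
    refine ⟨ball (0 : EuclideanSpace ℝ (Fin 3)) (n x₀), isOpen_ball.mem_nhds (hxn x₀), ?_⟩
    have h1 : IntegrableOn (fun x => ‖Y (n x₀) x‖ ^ 2) (ball (0 : EuclideanSpace ℝ (Fin 3)) (n x₀))
        volume := ((hY2 (n x₀)).integrable_norm_pow two_ne_zero).integrableOn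
    refine h1.congr_fun_ae ?_
    have h2 := hvT_ball (n x₀)
    rw [Filter.EventuallyEq, ae_restrict_iff' measurableSet_ball]
    filter_upwards [h2] with x hx hxb
    rw [hx hxb]
  · -- the pairings
    intro φ hφ
    obtain ⟨r, hr⟩ := (hφ.hasCompactSupport.isCompact.isBounded).subset_ball
      (0 : EuclideanSpace ℝ (Fin 3))
    set k : ℕ := ⌈r⌉₊ with hk
    have hφk : tsupport φ ⊆ ball (0 : EuclideanSpace ℝ (Fin 3)) k :=
      hr.trans (ball_subset_ball (by rw [hk]; exact Nat.le_ceil r))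
    have h1 := hYlim k φ hφ (hφk.trans ball_subset_closedBall)
    have h2 : ∫ x, ⟪Y k x, φ x⟫ = ∫ x, ⟪vT x, φ x⟫ := by
      refine integral_congr_ae ?_
      filter_upwards [hvT_ball k] with x hx
      by_cases hxb : x ∈ ball (0 : EuclideanSpace ℝ (Fin 3)) k
      · rw [hx hxb]
      · have h0 : φ x = 0 := image_eq_zero_of_notMem_tsupport fun h => hxb (hφk h)
        simp only [h0, inner_zero_right]
    rw [← h2]
    exact h1

end Trace

end Literature.Analysis.FluidPDE

end
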